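/- Width seat `ym-line-cbag-p1-w3` (prover-ym-line-cbag-p1-w3-g0-0), route `ColdBoxAllGroups`, crux `BoxFloorAllGroups`
(stmt-QuantumFields-22254), line `birth`, lead's PLAN v5: glue «CoreChartG» = B4' ∘ B9a (the core bound from primitive chart hypotheses). -/
import Summits.QuantumFields.YangMills.Theorems.ColdBoxAllGroupsBoxFloorAllGroupsCoreG
import Summits.QuantumFields.YangMills.Theorems.ColdBoxAllGroupsBoxFloorAllGroupsRepresentationGBall
import Summits.QuantumFields.YangMills.Theorems.ColdBoxAllGroupsBoxFloorAllGroupsChartWindowG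

/-!
# Crux `BoxFloorAllGroups`, stub S2, glue «CoreChartG»: the deterministic core bound from the primitive chart hypotheses
# (representation B4' fed into the lead's core B9a)

The lead's `abs_boxPlaqCov_sub_dirCircSqCov_le_coreG` (brick B9a «CoreG», p582574) takes the REPRESENTATION as a hypothesis `hrep`; brick B4'
`integral_cond_boxState_eq_integral_tilted_G'` (`…RepresentationGBall`, p582531) proves it from the primitive hypotheses of the exponential
chart — the link window in the chart ball (`hball`, discharged eventually in `β` by `…ChartWindowG`), the chart density on the ball
(`hdens`, `hgpos`: the lead's soft density or the Helgason Jacobian `J` of `…ChartDensityJ`), and the charged events (`hG0` from B2,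
`hγ` from `…GaussTailD`).  This file composes the two once and for all:
**`abs_boxPlaqCov_sub_dirCircSqCov_le_coreChartG`** — the conclusion of B9a from `hball`, `hdens`, `hgpos`, `hg` (log bound), the Gaussian
window, `hG0`, and `hcond` (B2); `hγ` is DISCHARGED here from the Gaussian window (`gaussD(Sᶜ) ≤ p < 1`).
No sorry; no definition; standard axioms.  NOT a claim about the mass gap (rung-level support, RECORD label).
-/

set_option autoImplicit false

noncomputable section

open MeasureTheory ProbabilityTheory Finset Real Metric
open scoped ENNReal Matrix.Norms.Frobenius
open Literature.Probability.LatticeModels (Site)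
open Literature.MathematicalPhysics.QuantumLattice
open Literature.MathematicalPhysics.QuantumFieldTheory
open Literature.MathematicalPhysics.QuantumFieldTheory.LatticeMaxwell
open Literature.MathematicalPhysics.QuantumFieldTheory.AxialGauge

namespace Summit.QuantumFields.YangMills.Theorems.ColdBoxAllGroups

open Summit.QuantumFields.YangMills.Theorems.WeakCouplingRates
open Summit.QuantumFields.YangMills.Theorems.FreeEnergyLogCoefficient

variable {H : ℕ} {N : ℕ} {G : Type} [Group G] [TopologicalSpace G] [IsTopologicalGroup G] [CompactSpace G]
  [MeasurableSpace G] [BorelSpace G] [SecondCountableTopology G] (ρ : G →* Matrix (Fin N) (Fin N) ℂ)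

/-- **The deterministic core of the one-scale expansion from the primitive chart hypotheses** (B4' ∘ B9a).  For a continuous faithful
unitary `ρ : G →* U(N)`, `D = dimE ρ`, half-side `H ≥ 1`, `β ≥ 1`, `T ≤ H`, small-field scale `ε`; link radius `0 ≤ m ≤ 1/4` with the
link window inside `expChart ρ '' closedBall 0 m` (`hball`); a chart density `g` on the ball (`hdens` with constant `c ∈ (0,∞)`, `g > 0` and
`|log g| ≤ ℓ` on `‖a‖ ≤ m`); the Gaussian window (`R`, `m_E ≤ min(m,1/4)`, cubic window) with `240·D·(2H+1)⁴e^{−R²/2} ≤ p < 1`; the charged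
good event `hG0`; and the large-field conditioning error `c₀` (`hcond`):
`|β²·boxPlaqCov ρ β H T − (D/4)·boxDirCircSqCov H T| ≤ β²c₀ + 3M²(e^{2w}−1) + 6M²p + 2τ(M+D) + √p·(2MD + 3D² + D²)`
(`M = β^{2ε}`, `τ = 190βm³`, `w = #Λ'·τ + #(ColdFreeIdx H)·ℓ`). -/
theorem abs_boxPlaqCov_sub_dirCircSqCov_le_coreChartG (hρc : Continuous ρ) (hinj : Function.Injective ρ)
    (hρu : ∀ g, ρ g ∈ Matrix.unitaryGroup (Fin N) ℂ) {β ε m ℓ R p c₀ : ℝ} {T : ℕ}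
    {g : EuclideanSpace ℝ (Fin (dimE ρ)) → ℝ} (hgm : Measurable g)
    (hβ : 1 ≤ β) (hH : 1 ≤ H) (hT : T ≤ H) (hm0 : 0 ≤ m) (hm4 : m ≤ 1 / 4) (hℓ : 0 ≤ ℓ)
    (hball : ∀ u : G, ‖ρ u - 1‖ ≤ (12 * (H : ℝ) ^ 2 + 2 * H + 1) * (Real.sqrt 2 * Real.sqrt (β ^ (2 * ε - 1))) →
      u ∈ expChart ρ '' closedBall (0 : EuclideanSpace ℝ (Fin (dimE ρ))) m)
    (hgpos : ∀ a, ‖a‖ ≤ m → 0 < g a) (hg : ∀ a, ‖a‖ ≤ m → |Real.log (g a)| ≤ ℓ) {c : ℝ≥0∞} (hc0 : c ≠ 0) (hctop : c ≠ ∞)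
    (hdens : (chartMeasureE ρ (1 / 4)).restrict (closedBall 0 m) =
      (c • (volume : Measure (EuclideanSpace ℝ (Fin (dimE ρ)))).restrict (closedBall 0 m)).withDensity
        (fun a => ENNReal.ofReal (g a)))
    (hR : 0 ≤ R)
    (hmE : Real.sqrt (dimE ρ) * ((12 * (H : ℝ) ^ 2 + 2 * H + 1) * R) / Real.sqrt β ≤ 1 / 4)
    (hmEm : Real.sqrt (dimE ρ) * ((12 * (H : ℝ) ^ 2 + 2 * H + 1) * R) / Real.sqrt β ≤ m)
    (hwin : (dimE ρ : ℝ) / 2 * R ^ 2 / β + 190 * (Real.sqrt (dimE ρ) * ((12 * (H : ℝ) ^ 2 + 2 * H + 1) * R) / Real.sqrt β) ^ 3 <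
      β ^ (2 * ε - 1))
    (hp : 240 * (dimE ρ) * (2 * (H : ℝ) + 1) ^ 4 * Real.exp (-R ^ 2 / 2) ≤ p) (hp1 : p < 1)
    (hG0 : boxState ρ β H (coldGoodSetG ρ H β ε) ≠ 0)
    (hcond : |boxPlaqCov ρ β H T -
        ((∫ U, plaqCostAt ρ (boxCentre H) 1 2 U * plaqCostAt ρ (boxCentre H + Pi.single 0 (T : ℤ)) 1 2 U
            ∂((boxState ρ β H)[|coldGoodSetG ρ H β ε])) -
          (∫ U, plaqCostAt ρ (boxCentre H) 1 2 U ∂((boxState ρ β H)[|coldGoodSetG ρ H β ε])) *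
          (∫ U, plaqCostAt ρ (boxCentre H + Pi.single 0 (T : ℤ)) 1 2 U ∂((boxState ρ β H)[|coldGoodSetG ρ H β ε])))| ≤ c₀) :
    |β ^ 2 * boxPlaqCov ρ β H T - (dimE ρ : ℝ) / 4 * boxDirCircSqCov H T| ≤
      β ^ 2 * c₀ + 3 * (β ^ (2 * ε)) ^ 2 * (Real.exp (2 * ((#(plaquettesTouching (boxEdges 4 (2 * H + 1))) : ℝ) * (190 * β * m ^ 3) +
          (Fintype.card (ColdFreeIdx H) : ℝ) * ℓ)) - 1) +
        6 * (β ^ (2 * ε)) ^ 2 * p + 2 * (190 * β * m ^ 3) * (β ^ (2 * ε) + dimE ρ) +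
        Real.sqrt p * (2 * β ^ (2 * ε) * dimE ρ + 3 * (dimE ρ : ℝ) ^ 2 + (dimE ρ : ℝ) ^ 2) := by
  have hβ0 : 0 < β := by linarith
  -- the Gaussian event is charged: `gaussD(Sᶜ) ≤ p < 1`
  haveI : IsProbabilityMeasure (gaussD H (dimE ρ)) := isProbabilityMeasure_gaussD H (dimE ρ)
  have hSm : MeasurableSet (goodTE ρ H β ε ∩ {t | ∀ e, ‖unscaleTE H (dimE ρ) β t e‖ ≤ m}) :=
    (measurableSet_goodTE ρ hρc hinj β ε).inter (measurableSet_ball_unscaleTE (dimE ρ) β m)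
  have hγ : gaussD H (dimE ρ) (goodTE ρ H β ε ∩ {t | ∀ e, ‖unscaleTE H (dimE ρ) β t e‖ ≤ m}) ≠ 0 :=
    measure_ne_zero_of_real_compl_lt_one (gaussD H (dimE ρ)) hSm
      (((gaussD_real_compl_goodTE_inter_ball_le ρ hρc hβ0 hH hR hmE hmEm hwin).trans hp).trans_lt hp1)
  -- the representation (B4') as the `hrep` input of the core (B9a)
  have hrep : ∀ X : LGConfig 4 G → ℝ, Measurable X → IsZdGaugeInvariant X → (∀ U, 0 ≤ X U) →
      ∫ U, X U ∂((boxState ρ β H)[|coldGoodSetG ρ H β ε]) =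
        ∫ t, X (cfgTE ρ H β t) ∂(((gaussD H (dimE ρ))[|(goodTE ρ H β ε ∩ {t | ∀ e, ‖unscaleTE H (dimE ρ) β t e‖ ≤ m})]).tilted
          ((goodTE ρ H β ε ∩ {t | ∀ e, ‖unscaleTE H (dimE ρ) β t e‖ ≤ m}).indicator (tiltWE ρ H g β))) :=
    fun X hXm hXinv hX0 =>
      integral_cond_boxState_eq_integral_tilted_G' ρ hρc hinj hρu hβ0 hH hm4 hball hgm hgpos hc0 hctop hdens hG0 hγ hXm hXinv hX0
  exact abs_boxPlaqCov_sub_dirCircSqCov_le_coreG ρ hρc hinj hρu hgm hβ hH hT hm0 hm4 hℓ hg hR hmE hmEm hwin hp hp1 hrep hcond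

end Summit.QuantumFields.YangMills.Theorems.ColdBoxAllGroups

end
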